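import Mathlib.Algebra.Module.CharacterModule
import Literature.NumberTheory.GaloisRepresentations.ContinuousCohomologyConnecting
import Literature.NumberTheory.GaloisRepresentations.GaloisCohomology
import Literature.NumberTheory.EllipticCurves.AnticyclotomicBigGaloisRep
import Literature.NumberTheory.EllipticCurves.GreenbergSelmer
import Literature.NumberTheory.EllipticCurves.IwasawaAlgebra
import HarnessLib

/-!
# The Selmer groups `Sel^Σ_𝔮(K, M)` of the anticyclotomic big Galois representation
# `M = T ⊗_𝒪 Λ_𝒪^*(Ψ⁻¹)` and their Pontryagin duals `X^Σ_ac = Sel^Σ_𝔮(K, M)^∨` — the Literature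
# currency (local maps, strict sets, Selmer shape) for the erratum's `X^Σ_ac(A_g)`

Cell `bsd-stepL` (crux `stmt-BirchSwinnertonDyer-19270`, Road FF; SPEC-19270-RoadFF D1/D2 follow-up:
the big representation `AnticyclotomicBigGaloisRep κ ρ` landed in
`Literature/NumberTheory/EllipticCurves/AnticyclotomicBigGaloisRep.lean`, which leaves "the local
maps `ψ_v : Γ_v →ₜ* Γ₀` and the strict set `L₀`" to the consumer). DEFINITIONS WITH BODIES and
proved unfolding lemmas only: no named fact, no `sorry`, no notation; instances only on the new
carrier family `LocalGroup K i`.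

## Source, verbatim

* F. Castella, Camb. J. Math. 6 (2018) §2.1, Def. 2.1–2.2 (author PDF p. 4): "for every place `w`
  of `K` define the anticyclotomic local condition … `H¹_ac(K_w, V) := H¹(K_𝔭̄, V)` if `w = 𝔭̄`;
  `0` if `w = 𝔭`; `H¹_ur(K_w, V)` if `w ∤ p`, where `H¹_ur(K_w, V) := ker{H¹(K_w, V) → H¹(I_w, V)}`
  is the unramified part of cohomology. … **Definition 2.2.** The anticyclotomic Selmer group for `E`
  over `K_∞^ac/K` is defined by `Sel_𝔭(K_∞, E[p^∞]) := ker{H¹(K, 𝒜) → H¹(K_𝔭, 𝒜) ⊕ ∏_{w∤p} H¹(K_w, 𝒜)}`.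
  More generally, for any given finite set `Σ` of places `w ∤ p` of `K`, define the
  '`Σ`-imprimitive' Selmer group `Sel^Σ_𝔭(K_∞, E[p^∞])` by dropping the summands `H¹(K_w, 𝒜)` for the
  places `w ∈ Σ` in the above definition. Set `X^Σ_ac(E[p^∞]) := Hom_{ℤ_p}(Sel^Σ_𝔭(K_∞, E[p^∞]), ℚ_p/ℤ_p)`".
* F. Castella, Erratum §2 (p. 2): "For any finite set `Σ` of primes `v ∤ p` of `K` … define
  `Sel^Σ_𝔭(K, M_g)` following [Cas18, Def. 2.2] … Write `X^Σ_ac(A_g) = Sel^Σ_𝔭(K, M_g)^*` for the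
  Pontryagin dual"; proof of Lemma 2.1: "Let `S_p` be the set of primes of `K` above `p`, put
  `S = Σ ∪ S_p`, and denote by `G_{K,S}` the Galois group of the maximal algebraic extension of `K`
  unramified outside `S`. By our assumption on `Σ` [`Σ ⊇` the primes `v ∤ p` where `T_g` is
  ramified], the Selmer groups `Sel^Σ_𝔭(K, M_g)` and `Sel^Σ_𝔭(K, M_g[ϖ^m])` are submodules of
  `H¹(G_{K,S}, M_g)` and `H¹(G_{K,S}, M_g[ϖ^m])` … `Sel^Σ_𝔭(K, M_g)[ϖ^m]` is the kernel of the
  composite map `H¹(G_{K,S}, M_g[p^m]) → H¹(K_𝔭, M_g[ϖ^m]) → H¹(K_𝔭, M_g)[ϖ^m]`."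
* R. Greenberg, Adv. Stud. Pure Math. 17 (1989) §1 p. 98: "choose a place of `ℚ̄` over `v` and let
  `I_v` and `D_v` denote the inertia and decomposition group".

## What is defined (namespace `Literature.NumberTheory.EllipticCurves.BigGaloisRep`)

* §1 **The Selmer shape**, for ANY continuous representation `ρ` of a topological group `Γ` on a
  discrete `A`-module `M`, a family of continuous homomorphisms `φ_v : Γ_v → Γ` and a set `L` of
  constrained indices: `resH1 ρ φ : H¹(Γ, M) → H¹(Γ_v, M)` (Mathlib `ContinuousCohomology.map`),
  **`selmer φ L ρ ⊆ H¹(Γ, M)`** = the classes restricting to `0` along every `φ_v`, `v ∈ L`, and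
  the torsion subrepresentation `torsionRep ρ r = M[r]` with `torsionIncl : M[r] ↪ M`. These are,
  with the SAME names and bodies, the declarations of the kernel file
  `Summits/BirchSwinnertonDyer/Rank1Residual/X11b/{SelmerTorsionControl,TorsionCohomologyControl}.lean`
  (namespace `Summit.….X11b.TorsionControl`), which a Literature file cannot import; they are
  re-homed here so that published statements about these Selmer groups ([SU14, Prop. 3.2.3] Shapiro;
  [FW21, Thm. 4.41] / erratum (2.5); [Ski16, (2-6-1)] congruences) can be typed in `Literature/`,
  the Summits twins being definitionally equal to these.
* §2 **The local data over `Γ_K`**: `LocalIndex K` (a finite place `w` tagged DECOMPOSITION,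
  `Sum.inl w`, or INERTIA, `Sum.inr w`), `LocalGroup K i` (`Γ_{K_w}`, resp. the tree's `absInertia K_w`),
  **`localMap K i : LocalGroup K i →ₜ* Γ_K`** (the tree's chosen `absGaloisRestrict K K_w`, resp. its
  composite with `I_{K_w} ↪ Γ_{K_w}`; images = `GreenbergSelmer.decomp w` / `GreenbergSelmer.inertia w`,
  `range_localMap_inl/inr`), and the strict sets **`strictSet p 𝔮 Σ`** = {decomposition at `𝔮`} ∪
  {inertia at every `w ∉ Σ`, `w ∤ p`} (the erratum's `ker{H¹(G_{K,S}, M) → H¹(K_𝔮, M)}`,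
  `S = Σ ∪ S_p`: classes unramified outside `S`, strict at `𝔮`, relaxed at the other primes above
  `p` and at `Σ`) and **`strictSetDecomp p 𝔮 Σ`** (Cas18 Def. 2.2 literally: trivial classes in
  `H¹(K_w, ·)` at `𝔮` and at every `w ∉ Σ`, `w ∤ p`). The strict prime is a parameter `𝔮`
  (Castella: `𝔭`, the prime of `ı_p`, relaxed at `𝔭̄`; CGLS/JSW: `v̄`; the kernel file writes `𝔭̄`).
* §3 **The objects**: for `κ : ZpExtension K p`, a discrete `𝒪`-linear `ρ : ContinuousRep Γ_K 𝒪 A`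
  (`A = T ⊗ Frac(𝒪)/𝒪`), the distinguished prime `𝔮` and `Σ`:
  **`selmerBig κ ρ 𝔮 Σ = Sel^Σ_𝔮(K, M)`** := `selmer (localMap K) (strictSet p 𝔮 Σ)
  (AnticyclotomicBigGaloisRep κ ρ)`, a `Λ_𝒪 = PowerSeries 𝒪`-submodule of `H¹(Γ_K, M)`;
  **`XBig κ ρ 𝔮 Σ = X^Σ_ac := Sel^Σ_𝔮(K, M)^∨`** (Mathlib `CharacterModule`, `Hom(·, ℚ/ℤ)`, with its
  `Λ_𝒪`-action `(r·x)(s) = x(r·s)`) and **`XBig.charIdeal`** (the tree's `Module.charIdeal` over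
  `Λ_𝒪`) — the erratum's `X^Σ_ac(A_g)` and `Ch_{Λ_𝒪}(X^Σ_ac(A_g))`; likewise `selmerBigDecomp` /
  `XBigDecomp` for the Def. 2.2 strict set.

## Notes for the consumer (kernel glue of crux 19270)

* The kernel's torsion-control lemma (`TorsionControl.selmerTorsionEquiv`) consumes local
  hypotheses index by index: at an INERTIA index the local invariants are all of `M` (the inertia
  group of an unramified place acts trivially), so the divisible-invariants form holds there
  trivially while the socle form ("no `Γ_v`-fixed vector in `M[𝔪]`") fails — use the divisible form
  (`map_charIdeal_le_span_of_roadFF_unr_le` already does).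
* `H¹(G_{K,S}, M) ⊆ H¹(K, M)` is the submodule of classes unramified outside `S` when `M` itself is
  unramified outside `S` (inflation–restriction); with that identification `selmerBig` IS the
  erratum's display. The comparison `strictSet` vs `strictSetDecomp` (at an unramified `w ∤ p`,
  `H¹_ur(K_w, T ⊗ Λ^*) = 0`; Cas18, display in the proof of Thm. 2.6) is NOT proved here.
* Nothing is asserted: finite generation, cotorsion, control, Shapiro's comparison with the tree's
  `K_∞`-formulation `Castella2018.AcSelmer.XAc` [SU14, Prop. 3.2.3], and the main conjectures are the
  cell's fact files.

References: [Castella2018] §2.1, Def. 2.1–2.2 (p. 4), proof of Thm. 2.6; [Castella2018Erratum] §2,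
Lemma 2.1 (p. 2); [Greenberg1989] §1 p. 98; [SkinnerUrban2014] §3.1.3, Prop. 3.2.3;
[SerreGaloisCohomology1997] I §2.2–2.4; [Skinner2016PacificMC] §2.3.
-/

noncomputable section

open CategoryTheory Field IsDedekindDomain NumberField
open Literature.NumberTheory.GaloisRepresentations
open scoped ContRepresentation

universe u

namespace Literature.NumberTheory.EllipticCurves.BigGaloisRep

/-! ### §1. The Selmer shape `Sel_L(Γ, M) = {c ∈ H¹(Γ, M) | res_{φ_v} c = 0 ∀ v ∈ L}` -/

section Shape

variable {A : Type*} [CommRing A] [TopologicalSpace A]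
variable {Γ : Type u} [Group Γ] [TopologicalSpace Γ]
variable {H : Type u} [Group H] [TopologicalSpace H]
variable {M : Type u} [AddCommGroup M] [Module A M] [TopologicalSpace M]

/-- `M[r]` is `Γ`-stable (the action is `A`-linear). Same body as the kernel's
`TorsionControl.torsionBy_le_comap`. [cite: Castella2018Erratum, Lemma 2.1 (p. 2, "the inclusion `M_g[ϖ^m] ⊂ M_g`")] -/
theorem torsionBy_le_comap (ρ : ContinuousRep Γ A M) (r : A) (g : Γ) :
    Submodule.torsionBy A M r ≤ (Submodule.torsionBy A M r).comap (ρ g) := by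
  intro m hm
  rw [Submodule.mem_comap, Submodule.mem_torsionBy_iff, ← map_smul,
    (Submodule.mem_torsionBy_iff r m).1 hm, map_zero]

/-- **The `r`-torsion subrepresentation `M[r] = {m ∈ M | r • m = 0}`** (`M_g[ϖ^m]`, `M_g[p^m]`).
Same body as the kernel's `TorsionControl.torsionRep`. [cite: Castella2018Erratum, §2 and Lemma 2.1 (p. 2, "`Sel^Σ_𝔭(K, M_g[ϖ^m])`", "`M_g[ϖ^m] ⊂ M_g`")] -/
def torsionRep (ρ : ContinuousRep Γ A M) (r : A) : ContinuousRep Γ A (Submodule.torsionBy A M r) :=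
  ρ.subrepresentation _ (torsionBy_le_comap ρ r)

/-- Unfolding `torsionRep`. [cite: Castella2018Erratum, Lemma 2.1 (p. 2)] -/
@[simp] theorem torsionRep_apply_coe (ρ : ContinuousRep Γ A M) (r : A) (g : Γ)
    (m : Submodule.torsionBy A M r) : ((torsionRep ρ r) g m : M) = ρ g m := rfl

variable [DiscreteTopology M] [ContinuousSMul A M]

/-- The inclusion `ι : M[r] ↪ M` as a morphism of the attached topological representations (same
body as the kernel's `TorsionControl.torsionIncl`). [cite: Castella2018Erratum, Lemma 2.1 (p. 2, "the inclusion `M_g[ϖ^m] ⊂ M_g` induces an isomorphism")] -/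
def torsionIncl (ρ : ContinuousRep Γ A M) (r : A) : (torsionRep ρ r).toTopRep ⟶ ρ.toTopRep :=
  TopRep.ofHom ⟨⟨(Submodule.torsionBy A M r).subtype, continuous_subtype_val⟩, fun σ => by
    ext m; rfl⟩

/-- Unfolding `torsionIncl`: it is the coercion `M[r] → M`. [cite: Castella2018Erratum, Lemma 2.1 (p. 2)] -/
@[simp] theorem torsionIncl_apply (ρ : ContinuousRep Γ A M) (r : A) (m : Submodule.torsionBy A M r) :
    (torsionIncl ρ r).hom m = (m : M) := rfl

/-- The identity of `M` as a morphism from `ρ` restricted along `φ : H → Γ` (Mathlib `TopRep.res`) to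
the tree's `ρ.restrict φ` (definitionally the same representation). Same body as the kernel's
`TorsionControl.resMod`. [cite: SerreGaloisCohomology1997, I §2.4 (restriction)] -/
def resMod (ρ : ContinuousRep Γ A M) (φ : H →ₜ* Γ) :
    TopRep.res (φ : H →* Γ) ρ.toTopRep ⟶ (ρ.restrict φ).toTopRep :=
  TopRep.ofHom ⟨ContinuousLinearMap.id A M, fun _ => rfl⟩

/-- Unfolding `resMod`. [cite: SerreGaloisCohomology1997, I §2.4] -/
@[simp] theorem resMod_hom_apply (ρ : ContinuousRep Γ A M) (φ : H →ₜ* Γ) (m : M) :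
    (resMod ρ φ).hom m = m := rfl

variable [IsTopologicalGroup Γ] [IsTopologicalGroup H]

/-- **The restriction map `res_φ : H¹(Γ, M) → H¹(H, M)`** along `φ : H → Γ` (Mathlib
`ContinuousCohomology.map φ`; for `φ` the inclusion of a decomposition group this is localisation at
the corresponding place, `H¹(K, M) → H¹(K_w, M)`; for an inertia group, `H¹(K, M) → H¹(I_w, M)`). Same
body as the kernel's `TorsionControl.resH1`. [cite: SerreGaloisCohomology1997, I §2.4 (restriction)] -/
abbrev resH1 (ρ : ContinuousRep Γ A M) (φ : H →ₜ* Γ) :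
    continuousCohomology 1 ρ.toTopRep ⟶ continuousCohomology 1 (ρ.restrict φ).toTopRep :=
  ContinuousCohomology.map φ (resMod ρ φ) 1

variable {ι : Type*} {Γv : ι → Type u} [∀ v, Group (Γv v)] [∀ v, TopologicalSpace (Γv v)]
  [∀ v, IsTopologicalGroup (Γv v)] (φ : ∀ v, Γv v →ₜ* Γ) (L : Set ι)

/-- **The Selmer group of `(Γ, (φ_v)_{v ∈ L})` with coefficients in `M`**: the `A`-submodule of
`H¹(Γ, M)` of classes restricting to zero along `φ_v : Γ_v → Γ` for every `v ∈ L` (no condition at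
`v ∉ L`). For `Γ = Γ_K`, `φ = localMap K` and `L = strictSet p 𝔮 Σ` this is the erratum's
`Sel^Σ_𝔮(K, M) = ker{H¹(G_{K,S}, M) → H¹(K_𝔮, M)}` (`S = Σ ∪ S_p`); with `L = strictSetDecomp p 𝔮 Σ` it
is Cas18 Def. 2.2 literally. Same body as the kernel's `TorsionControl.selmer`.
[cite: Castella2018, Def. 2.2 (p. 4)] [cite: Castella2018Erratum, §2 (p. 2, "`Sel^Σ_𝔭(K, M_g)`")] -/
def selmer (ρ : ContinuousRep Γ A M) : Submodule A (continuousCohomology 1 ρ.toTopRep) :=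
  ⨅ v ∈ L, LinearMap.ker (resH1 ρ (φ v)).hom.toLinearMap

/-- Membership in `selmer`: all constrained restrictions vanish. [cite: Castella2018, Def. 2.2 (p. 4, "`ker{H¹(K, 𝒜) → H¹(K_𝔭, 𝒜) ⊕ ∏_{w∤p} H¹(K_w, 𝒜)}`")] -/
theorem mem_selmer_iff (ρ : ContinuousRep Γ A M) (x : continuousCohomology 1 ρ.toTopRep) :
    x ∈ selmer φ L ρ ↔ ∀ v ∈ L, resH1 ρ (φ v) x = 0 := by
  simp only [selmer, Submodule.mem_iInf, LinearMap.mem_ker]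
  rfl

/-- `selmer` is antitone in the constrained set: more local conditions, smaller Selmer group
(`Sel^{Σ₁} ⊆ Sel^{Σ₂}` for `Σ₁ ⊆ Σ₂`). [cite: Castella2018, Def. 2.2 (p. 4, "dropping the summands `H¹(K_w, 𝒜)` for the places `w ∈ Σ`")] -/
theorem selmer_anti (ρ : ContinuousRep Γ A M) {L₁ L₂ : Set ι} (h : L₁ ⊆ L₂) :
    selmer φ L₂ ρ ≤ selmer φ L₁ ρ := fun x hx =>
  (mem_selmer_iff φ L₁ ρ x).2 fun v hv => (mem_selmer_iff φ L₂ ρ x).1 hx v (h hv)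

end Shape

/-! ### §2. Local data over `Γ_K`: the maps `Γ_{K_w} → Γ_K`, `I_{K_w} → Γ_K` and the strict sets -/

section LocalIndex

variable (K : Type u) [Field K]

/-- **Index of a local condition**: a finite place `w` of `K` tagged DECOMPOSITION (`Sum.inl w`:
the condition "the class dies in `H¹(K_w, M)`", restriction along `Γ_{K_w} → Γ_K`) or INERTIA
(`Sum.inr w`: "the class is unramified at `w`", restriction along `I_{K_w} → Γ_K`). The index type
of the family `ψ` fed to the kernel's `TorsionControl.selmer ψ L₀`. [folklore] -/
abbrev LocalIndex : Type u :=
  HeightOneSpectrum (𝓞 K) ⊕ HeightOneSpectrum (𝓞 K)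

variable {K}

/-- **The strict set of the erratum's `Sel^Σ_𝔮(K, M) = ker{H¹(G_{K,S}, M) → H¹(K_𝔮, M)}`,
`S = Σ ∪ S_p`**: the DECOMPOSITION condition at the distinguished prime `𝔮` above `p` (strict:
"`0` if `w = 𝔭`"), the INERTIA condition (unramified) at every finite `w ∉ Σ` not above `p`, and NO
condition at the other primes above `p` (relaxed: "`H¹(K_𝔭̄, V)` if `w = 𝔭̄`") nor at `w ∈ Σ`
(`Σ`-imprimitive). With `ψ = localMap K`, the kernel's `TorsionControl.selmer ψ (strictSet p 𝔮 Σ)`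
of `AnticyclotomicBigGaloisRep ρ hρ κ` is this group (the submodule `H¹(G_{K,S}, M) ⊆ H¹(K, M)` being
the classes unramified outside `S`, for `M` unramified outside `S`).
[cite: Castella2018Erratum, §2 and proof of Lemma 2.1 (p. 2, "`Sel^Σ_𝔭(K, M_g)`", "submodules of `H¹(G_{K,S}, M_g)`")]
[cite: Castella2018, Def. 2.2 (p. 4)] -/
def strictSet (p : ℕ) (𝔮 : HeightOneSpectrum (𝓞 K)) (S : Set (HeightOneSpectrum (𝓞 K))) :
    Set (LocalIndex K) := fun i =>
  match i with
  | Sum.inl w => w = 𝔮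
  | Sum.inr w => w ∉ S ∧ ((p : ℕ) : 𝓞 K) ∉ w.asIdeal

/-- **Castella's Def. 2.2 literally**: the decomposition (trivial-class) condition at `𝔮` AND at
every finite `w ∉ Σ` not above `p` ("`ker{H¹(K, 𝒜) → H¹(K_𝔭, 𝒜) ⊕ ∏_{w∤p, w∉Σ} H¹(K_w, 𝒜)}`"), no
inertia index. For `Σ ⊇ {w ∤ p : T ramified at w}` this cuts out the same group as `strictSet` (at an
unramified `w ∤ p`, `H¹_ur(K_w, T ⊗ Λ^*) = 0`; Cas18, display in the proof of Thm. 2.6) — that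
comparison is PROVED in `Castella2018/SigmaSelmerUnramifiedOutsideSProofs.lean` (`selmerBig_eq_selmerBigDecomp_of_unramifiedOutside_holds`, the discharge of the named fact `selmerBig_eq_selmerBigDecomp_of_unramifiedOutside`; doc-debt DD-154). [cite: Castella2018, Def. 2.2 (p. 4, "`Sel^Σ_𝔭(K_∞, E[p^∞])` by dropping the summands `H¹(K_w, 𝒜)` for the places `w ∈ Σ`")] -/
def strictSetDecomp (p : ℕ) (𝔮 : HeightOneSpectrum (𝓞 K)) (S : Set (HeightOneSpectrum (𝓞 K))) :
    Set (LocalIndex K) := fun i =>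
  match i with
  | Sum.inl w => w = 𝔮 ∨ (w ∉ S ∧ ((p : ℕ) : 𝓞 K) ∉ w.asIdeal)
  | Sum.inr _ => False

/-- A decomposition index is constrained in `strictSet` iff it is `𝔮` (the other primes above `p`
and the places in `Σ` carry no decomposition condition). [cite: Castella2018, Def. 2.2 (p. 4, "`0` if `w = 𝔭`")] -/
@[simp] theorem inl_mem_strictSet_iff (p : ℕ) (𝔮 w : HeightOneSpectrum (𝓞 K))
    (S : Set (HeightOneSpectrum (𝓞 K))) :
    (Sum.inl w : LocalIndex K) ∈ strictSet p 𝔮 S ↔ w = 𝔮 :=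
  Iff.rfl

/-- The decomposition index of `𝔮` is constrained. [cite: Castella2018, Def. 2.2 (p. 4, "`0` if `w = 𝔭`")] -/
theorem inl_self_mem_strictSet (p : ℕ) (𝔮 : HeightOneSpectrum (𝓞 K))
    (S : Set (HeightOneSpectrum (𝓞 K))) : (Sum.inl 𝔮 : LocalIndex K) ∈ strictSet p 𝔮 S :=
  (inl_mem_strictSet_iff p 𝔮 𝔮 S).2 rfl

/-- An inertia index `w` is constrained in `strictSet` iff `w ∉ Σ` and `w ∤ p` (unramified outside
`S = Σ ∪ S_p`). [cite: Castella2018Erratum, proof of Lemma 2.1 (p. 2, "`S = Σ ∪ S_p`")] -/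
@[simp] theorem inr_mem_strictSet_iff (p : ℕ) (𝔮 w : HeightOneSpectrum (𝓞 K))
    (S : Set (HeightOneSpectrum (𝓞 K))) :
    (Sum.inr w : LocalIndex K) ∈ strictSet p 𝔮 S ↔ w ∉ S ∧ ((p : ℕ) : 𝓞 K) ∉ w.asIdeal :=
  Iff.rfl

/-- Membership of a decomposition index in `strictSetDecomp`. [cite: Castella2018, Def. 2.2 (p. 4)] -/
@[simp] theorem inl_mem_strictSetDecomp_iff (p : ℕ) (𝔮 w : HeightOneSpectrum (𝓞 K))
    (S : Set (HeightOneSpectrum (𝓞 K))) :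
    (Sum.inl w : LocalIndex K) ∈ strictSetDecomp p 𝔮 S ↔
      w = 𝔮 ∨ (w ∉ S ∧ ((p : ℕ) : 𝓞 K) ∉ w.asIdeal) :=
  Iff.rfl

/-- No inertia index lies in `strictSetDecomp`. [cite: Castella2018, Def. 2.2 (p. 4)] -/
@[simp] theorem inr_not_mem_strictSetDecomp (p : ℕ) (𝔮 w : HeightOneSpectrum (𝓞 K))
    (S : Set (HeightOneSpectrum (𝓞 K))) :
    (Sum.inr w : LocalIndex K) ∉ strictSetDecomp p 𝔮 S :=
  fun h => h

/-- The decomposition constraints of `strictSet` are among those of `strictSetDecomp`.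
[cite: Castella2018, Def. 2.2 (p. 4)] -/
theorem inl_mem_strictSetDecomp_of_mem_strictSet (p : ℕ) (𝔮 w : HeightOneSpectrum (𝓞 K))
    (S : Set (HeightOneSpectrum (𝓞 K))) (h : (Sum.inl w : LocalIndex K) ∈ strictSet p 𝔮 S) :
    (Sum.inl w : LocalIndex K) ∈ strictSetDecomp p 𝔮 S :=
  Or.inl h

/-- `strictSet` is antitone in `Σ` (enlarging `Σ` relaxes conditions: `Sel^{Σ₁} ⊆ Sel^{Σ₂}` for
`Σ₁ ⊆ Σ₂`). [cite: Castella2018, Def. 2.2 (p. 4, "`Σ`-imprimitive")] -/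
theorem strictSet_anti (p : ℕ) (𝔮 : HeightOneSpectrum (𝓞 K)) {S₁ S₂ : Set (HeightOneSpectrum (𝓞 K))}
    (h : S₁ ⊆ S₂) : strictSet p 𝔮 S₂ ⊆ strictSet p 𝔮 S₁ := by
  rintro (w | w) hw
  · exact hw
  · exact ⟨fun h₁ => hw.1 (h h₁), hw.2⟩

/-- `strictSetDecomp` is antitone in `Σ`. [cite: Castella2018, Def. 2.2 (p. 4, "`Σ`-imprimitive")] -/
theorem strictSetDecomp_anti (p : ℕ) (𝔮 : HeightOneSpectrum (𝓞 K))
    {S₁ S₂ : Set (HeightOneSpectrum (𝓞 K))} (h : S₁ ⊆ S₂) :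
    strictSetDecomp p 𝔮 S₂ ⊆ strictSetDecomp p 𝔮 S₁ := by
  rintro (w | w) hw
  · rcases hw with hw | hw
    · exact Or.inl hw
    · exact Or.inr ⟨fun h₁ => hw.1 (h h₁), hw.2⟩
  · exact hw.elim

end LocalIndex

section LocalGroup

variable (K : Type u) [Field K] [NumberField K]

/-- **The local group at an index**: `Γ_{K_w} = Gal(K̄_w/K_w)` (`K_w = w.adicCompletion K`) at a
decomposition index, the inertia group `I_{K_w} ≤ Γ_{K_w}` (tree `absInertia`) at an inertia index.
[cite: Greenberg1989, §1 p. 98 ("choose a place of `ℚ̄` over `v` and let `I_v` and `D_v` denote the inertia and decomposition group")] -/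
def LocalGroup : LocalIndex K → Type u
  | Sum.inl w => absoluteGaloisGroup (w.adicCompletion K)
  | Sum.inr w => ↥(absInertia (w.adicCompletion K))

namespace LocalGroup

/-- The local groups are groups (instance plumbing on the new carrier family). [folklore] -/
instance instGroup : ∀ i : LocalIndex K, Group (LocalGroup K i)
  | Sum.inl w => inferInstanceAs (Group (absoluteGaloisGroup (w.adicCompletion K)))
  | Sum.inr w => inferInstanceAs (Group ↥(absInertia (w.adicCompletion K)))

/-- The local groups are topological spaces (Krull topology, resp. its subspace topology).
[folklore] -/
instance instTopologicalSpace : ∀ i : LocalIndex K, TopologicalSpace (LocalGroup K i)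
  | Sum.inl w => inferInstanceAs (TopologicalSpace (absoluteGaloisGroup (w.adicCompletion K)))
  | Sum.inr w => inferInstanceAs (TopologicalSpace ↥(absInertia (w.adicCompletion K)))

/-- The local groups are topological groups. [folklore] -/
instance instIsTopologicalGroup : ∀ i : LocalIndex K, IsTopologicalGroup (LocalGroup K i)
  | Sum.inl w => inferInstanceAs (IsTopologicalGroup (absoluteGaloisGroup (w.adicCompletion K)))
  | Sum.inr w => inferInstanceAs (IsTopologicalGroup ↥(absInertia (w.adicCompletion K)))

end LocalGroup

/-- The inclusion `I_{K_w} ↪ Γ_{K_w}` as a continuous homomorphism. [folklore] -/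
def inertiaIncl (w : HeightOneSpectrum (𝓞 K)) :
    ↥(absInertia (w.adicCompletion K)) →ₜ* absoluteGaloisGroup (w.adicCompletion K) where
  toMonoidHom := (absInertia (w.adicCompletion K)).subtype
  continuous_toFun := continuous_subtype_val

/-- **The local maps `ψ_i : Γ_i → Γ_K`**: at a decomposition index `w` the restriction
`Γ_{K_w} → Γ_K` of the tree's chosen embedding `K̄ → K̄_w` (`absGaloisRestrict K K_w`, whose image IS
`GreenbergSelmer.decomp w`); at an inertia index the composite `I_{K_w} ↪ Γ_{K_w} → Γ_K` (image
`GreenbergSelmer.inertia w`). Restriction of classes along `ψ_{inl w}` is localisation at `w`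
(`H¹(K, M) → H¹(K_w, M)`), along `ψ_{inr w}` it is `H¹(K, M) → H¹(I_w, M)`.
[cite: Castella2018, §2.1 (p. 4, the local conditions `H¹(K_w, 𝒜)` and `H¹_ur(K_w, V) = ker{H¹(K_w, V) → H¹(I_w, V)}`)] -/
def localMap : ∀ i : LocalIndex K, LocalGroup K i →ₜ* absoluteGaloisGroup K
  | Sum.inl w => absGaloisRestrict K (w.adicCompletion K)
  | Sum.inr w => (absGaloisRestrict K (w.adicCompletion K)).comp (inertiaIncl K w)

/-- The image of the decomposition map at `w` is the tree's decomposition group `D_w ≤ Γ_K`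
(`GreenbergSelmer.decomp`). [cite: Greenberg1989, §1 p. 98] -/
theorem range_localMap_inl (w : HeightOneSpectrum (𝓞 K)) :
    (localMap K (Sum.inl w)).toMonoidHom.range = GreenbergSelmer.decomp w :=
  rfl

/-- The image of the inertia map at `w` is the tree's inertia group `I_w ≤ Γ_K`
(`GreenbergSelmer.inertia`). [cite: Greenberg1989, §1 p. 98] -/
theorem range_localMap_inr (w : HeightOneSpectrum (𝓞 K)) :
    (localMap K (Sum.inr w)).toMonoidHom.range = GreenbergSelmer.inertia w := by
  change ((absGaloisRestrict K (w.adicCompletion K)).toMonoidHom.comp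
    (absInertia (w.adicCompletion K)).subtype).range = _
  rw [MonoidHom.range_comp, Subgroup.range_subtype]
  rfl

end LocalGroup

/-! ### §3. `Sel^Σ_𝔮(K, M)` and `X^Σ_ac = Sel^Σ_𝔮(K, M)^∨` for `M = AnticyclotomicBigGaloisRep κ ρ` -/

section Objects

variable {K : Type u} [Field K] [NumberField K] {p : ℕ} [Fact p.Prime]
variable {𝒪 : Type*} [CommRing 𝒪] [TopologicalSpace 𝒪]
variable {A : Type u} [AddCommGroup A] [Module 𝒪 A] [TopologicalSpace A] [DiscreteTopology A]
variable [TopologicalSpace (PowerSeries 𝒪)] [ContinuousSMul (PowerSeries 𝒪) (BigRepModule 𝒪 p A)]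

/-- **`Sel^Σ_𝔮(K, M)` for `M = T ⊗_𝒪 Λ_𝒪^*(Ψ⁻¹)`** (`AnticyclotomicBigGaloisRep κ ρ`, the co-induced
model on `A = T ⊗ Frac(𝒪)/𝒪`): the classes of `H¹(Γ_K, M)` that are unramified at every finite
`w ∉ Σ` not above `p` and die in `H¹(K_𝔮, M)` — the erratum's
`Sel^Σ_𝔮(K, M) = ker{H¹(G_{K,S}, M) → H¹(K_𝔮, M)}`, `S = Σ ∪ S_p` (relaxed at the primes above `p`
other than `𝔮`), a `Λ_𝒪 = PowerSeries 𝒪`-submodule. Intended: `K` imaginary quadratic, `p = 𝔭𝔭̄`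
split, `κ` anticyclotomic, `𝔮` the strict prime (Castella's `𝔭`), `A = E[p^∞] ⊗ 𝒪` or `A_{g_m}`.
[cite: Castella2018Erratum, §2 and proof of Lemma 2.1 (p. 2, "`Sel^Σ_𝔭(K, M_g)`", "`S = Σ ∪ S_p`")]
[cite: Castella2018, Def. 2.2 (p. 4)] -/
def selmerBig (κ : ZpExtension K p) (ρ : ContinuousRep (absoluteGaloisGroup K) 𝒪 A)
    (𝔮 : HeightOneSpectrum (𝓞 K)) (S : Set (HeightOneSpectrum (𝓞 K))) :
    Submodule (PowerSeries 𝒪)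
      (continuousCohomology 1 (AnticyclotomicBigGaloisRep κ ρ).toTopRep) :=
  selmer (localMap K) (strictSet p 𝔮 S) (AnticyclotomicBigGaloisRep κ ρ)

/-- `Sel^Σ_𝔮(K, M)` with Cas18 Def. 2.2's strict set (trivial classes at `𝔮` and in `H¹(K_w, M)` for
every finite `w ∉ Σ`, `w ∤ p`). [cite: Castella2018, Def. 2.2 (p. 4, "`ker{H¹(K, 𝒜) → H¹(K_𝔭, 𝒜) ⊕ ∏_{w∤p} H¹(K_w, 𝒜)}` … dropping the summands for `w ∈ Σ`")] -/
def selmerBigDecomp (κ : ZpExtension K p) (ρ : ContinuousRep (absoluteGaloisGroup K) 𝒪 A)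
    (𝔮 : HeightOneSpectrum (𝓞 K)) (S : Set (HeightOneSpectrum (𝓞 K))) :
    Submodule (PowerSeries 𝒪)
      (continuousCohomology 1 (AnticyclotomicBigGaloisRep κ ρ).toTopRep) :=
  selmer (localMap K) (strictSetDecomp p 𝔮 S) (AnticyclotomicBigGaloisRep κ ρ)

/-- Unfolding `selmerBig`. [cite: Castella2018Erratum, §2 (p. 2)] -/
theorem selmerBig_eq (κ : ZpExtension K p) (ρ : ContinuousRep (absoluteGaloisGroup K) 𝒪 A)
    (𝔮 : HeightOneSpectrum (𝓞 K)) (S : Set (HeightOneSpectrum (𝓞 K))) :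
    selmerBig κ ρ 𝔮 S = selmer (localMap K) (strictSet p 𝔮 S) (AnticyclotomicBigGaloisRep κ ρ) :=
  rfl

/-- Membership in `Sel^Σ_𝔮(K, M)`: the class dies along `Γ_{K_𝔮} → Γ_K` and along `I_{K_w} → Γ_K` for
every finite `w ∉ Σ` with `w ∤ p`. [cite: Castella2018Erratum, §2 and proof of Lemma 2.1 (p. 2)] -/
theorem mem_selmerBig_iff (κ : ZpExtension K p) (ρ : ContinuousRep (absoluteGaloisGroup K) 𝒪 A)
    (𝔮 : HeightOneSpectrum (𝓞 K)) (S : Set (HeightOneSpectrum (𝓞 K)))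
    (x : continuousCohomology 1 (AnticyclotomicBigGaloisRep κ ρ).toTopRep) :
    x ∈ selmerBig κ ρ 𝔮 S ↔
      resH1 (AnticyclotomicBigGaloisRep κ ρ) (localMap K (Sum.inl 𝔮)) x = 0 ∧
        ∀ w : HeightOneSpectrum (𝓞 K), w ∉ S → ((p : ℕ) : 𝓞 K) ∉ w.asIdeal →
          resH1 (AnticyclotomicBigGaloisRep κ ρ) (localMap K (Sum.inr w)) x = 0 := by
  rw [selmerBig, mem_selmer_iff]
  constructor
  · intro h
    exact ⟨h _ (inl_self_mem_strictSet p 𝔮 S), fun w hw hp => h _ ((inr_mem_strictSet_iff p 𝔮 w S).2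
      ⟨hw, hp⟩)⟩
  · rintro ⟨h𝔮, hur⟩ (w | w) hw
    · rw [inl_mem_strictSet_iff] at hw
      subst hw
      exact h𝔮
    · exact hur w hw.1 hw.2

/-- `Sel^{Σ}_𝔮` grows with `Σ` (`Σ`-imprimitivity). [cite: Castella2018, Def. 2.2 (p. 4, "`Σ`-imprimitive")] -/
theorem selmerBig_mono (κ : ZpExtension K p) (ρ : ContinuousRep (absoluteGaloisGroup K) 𝒪 A)
    (𝔮 : HeightOneSpectrum (𝓞 K)) {S₁ S₂ : Set (HeightOneSpectrum (𝓞 K))} (h : S₁ ⊆ S₂) :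
    selmerBig κ ρ 𝔮 S₁ ≤ selmerBig κ ρ 𝔮 S₂ :=
  selmer_anti (localMap K) _ (strictSet_anti p 𝔮 h)

/-- **`X^Σ_ac := Sel^Σ_𝔮(K, M)^∨`**, the Pontryagin dual (Mathlib `CharacterModule`, `Hom(·, ℚ/ℤ)`,
`Λ_𝒪`-action `(r·x)(s) = x(r·s)`) — the erratum's `X^Σ_ac(A_g) = Sel^Σ_𝔭(K, M_g)^*`.
[cite: Castella2018Erratum, §2 (p. 3 top, "`X^Σ_ac(A_g) = Sel^Σ_𝔭(K, M_g)^*` for the Pontryagin dual")]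
[cite: Castella2018, Def. 2.2 (p. 4, "`X^Σ_ac(E[p^∞]) := Hom_{ℤ_p}(Sel^Σ_𝔭(K_∞, E[p^∞]), ℚ_p/ℤ_p)`")] -/
abbrev XBig (κ : ZpExtension K p) (ρ : ContinuousRep (absoluteGaloisGroup K) 𝒪 A)
    (𝔮 : HeightOneSpectrum (𝓞 K)) (S : Set (HeightOneSpectrum (𝓞 K))) : Type u :=
  CharacterModule (selmerBig κ ρ 𝔮 S)

/-- `X^Σ_ac` for the Def. 2.2 strict set. [cite: Castella2018, Def. 2.2 (p. 4)] -/
abbrev XBigDecomp (κ : ZpExtension K p) (ρ : ContinuousRep (absoluteGaloisGroup K) 𝒪 A)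
    (𝔮 : HeightOneSpectrum (𝓞 K)) (S : Set (HeightOneSpectrum (𝓞 K))) : Type u :=
  CharacterModule (selmerBigDecomp κ ρ 𝔮 S)

/-- **`Ch_{Λ_𝒪}(X^Σ_ac)`**, the characteristic ideal of the `Λ_𝒪`-module `X^Σ_ac` (the tree's
`Module.charIdeal`: product over height-one primes; meaningful for finitely generated torsion
modules, NOT asserted here) — the left-hand side of the erratum's (2.5)
`Ch_{Λ_𝒪}(X^Σ_ac(A_g))Λ_𝒪^ur ⊂ (L^Σ_p(g))`. [cite: Castella2018Erratum, Thm. 2.3 and (2.5) (pp. 3–4, "`Ch_{Λ_𝒪}(X^Σ_ac(A_g))`")] -/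
def XBig.charIdeal (κ : ZpExtension K p) (ρ : ContinuousRep (absoluteGaloisGroup K) 𝒪 A)
    (𝔮 : HeightOneSpectrum (𝓞 K)) (S : Set (HeightOneSpectrum (𝓞 K))) : Ideal (PowerSeries 𝒪) :=
  Literature.NumberTheory.EllipticCurves.Module.charIdeal (PowerSeries 𝒪) (XBig κ ρ 𝔮 S)

end Objects

end Literature.NumberTheory.EllipticCurves.BigGaloisRep

end
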